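import Summits.RiemannHypothesis.RiemannHypothesis.Theorems.OddSectorOddOneSignedWindowsFormDomainDilation
import Summits.RiemannHypothesis.RiemannHypothesis.Theorems.WeilParityEvenWinsBeyondArchStubSectorContinuity
import Summits.RiemannHypothesis.RiemannHypothesis.Theorems.OddSectorOddOneSignedWindowsRenorm
import Summits.RiemannHypothesis.RiemannHypothesis.Theorems.WeilGroundStateMarkovPartPositiveGroundStatePhase
import HarnessLib

/-!
# Odd window tests are dense from above in the ODD form domain of the window
# (helper for crux `OddSector.OddOneSignedWindows`, item stmt-RiemannHypothesis-17778; RH-free)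

The odd-sector twin of `WeilWindowFlowWindowLipschitz.stub_formDomainPos` (route WeilWindowFlow):
for every ODD `f ∈ L²` vanishing off `[-a, a]` (`a > 0`) with finite archimedean energy,

  `(M_a + ε_od(a)) ‖f‖₂² ≤ P(f) + 𝓔_a(f)`            (`odd_formDomainPos`)

(`P = weilPoleForm`, `𝓔_a = weilDirichletEnergy a`, `M_a = weilMarkovConstant a`,
`ε_od = weilOddGroundEnergy`). On odd window TEST functions this is `ε_od(a)‖f‖² ≤ Re Q(f)`
(`weilOddGroundEnergy_le`) plus the Markov decomposition; the content is the extension to the odd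
finite-energy class — the odd sector of the closed form has the odd tests as a core. Together with
`IsWeilOddGroundState.finiteEnergy` (`P(u) + 𝓔_a(u) ≤ M_a + ε_od(a)` for an odd ground state) it
says that odd ground states MINIMISE `P + 𝓔_a` over the odd finite-energy unit sphere of the window:
the variational principle in the form domain that first-variation (weak Euler–Lagrange against
finite-energy odd directions, e.g. the BV theta vector `H_a` of `OddBartaFloor`, or truncations of
`u` itself) and comparison arguments for the SIGN of `u` start from.

## Proof

As in the even twin: mollify `f` by EVEN bumps (`exists_odd_mollified_seq`: ODD tests `gₙ` on the
slightly larger windows `bₙ = a + 1/(n+1)`, increments dominated by those of `f`, `gₙ → f` in `L²`);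
`ε_od(bₙ)‖gₙ‖² ≤ Re Q(gₙ) = P(gₙ) + 𝓔_{bₙ}(gₙ) − M_{bₙ}‖gₙ‖²`, `𝓔_{bₙ}(gₙ) ≤ 𝓔_{bₙ}(f) = 𝓔_a(f) +
(M_{bₙ} − M_a)‖f‖²` (the new prime lengths see disjoint translates); let `n → ∞` using
`P(gₙ) → P(f)`, `‖gₙ‖² → ‖f‖²`, bounded `M_{bₙ}` and the CONTINUITY OF `ε_od`
(`stub_sectorContinuity_continuousAt_odd`, route WeilParity).

References: M. Fukushima, Y. Oshima, M. Takeda (2011), §1.1; E. Bombieri, Rend. Mat. Acc. Lincei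
(9) 11 (2000), Thm 2 and §4 Thm 5.
-/

noncomputable section

set_option linter.dupNamespace false

open MeasureTheory Set Filter
open scoped Topology ENNReal ArithmeticFunction.vonMangoldt

namespace Summit.RiemannHypothesis.RiemannHypothesis.Theorems.OddSector

open Literature.NumberTheory.LFunctions Literature.NumberTheory.LFunctions.ConnesVanSuijlekom
open Summit.RiemannHypothesis.RiemannHypothesis.Theorems.WeilGroundStateMarkovPart
open Summit.RiemannHypothesis.RiemannHypothesis.Theorems.WeilWindowFlowWindowLipschitz

/-! ### Energies of nested windows -/

/-- Enlarging the window from `a` to `b ≥ a` adds to the energy of a function living on `[-a, a]`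
exactly the new prime lengths `2a ≤ log n < 2b`, each with the saturated increment `2‖f‖₂²`:
`𝓔_b(f) = 𝓔_a(f) + (M_b − M_a)‖f‖₂²`. [folklore] -/
theorem weilDirichletEnergy_window' {a b : ℝ} (hab : a ≤ b) {f : ℝ → ℂ} (hf : MemLp f 2)
    (hfs : ∀ x, x ∉ Icc (-a) a → f x = 0) :
    weilDirichletEnergy b f = weilDirichletEnergy a f +
      (weilMarkovConstant b - weilMarkovConstant a) * ∫ x, ‖f x‖ ^ 2 := by
  -- adapted from the private `weilDirichletEnergy_window` (route WeilWindowFlow)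
  set N : ℝ := ∫ x, ‖f x‖ ^ 2
  have hsub := stub_supBound_weilPrimeIndex_mono hab
  have hD : ∀ n ∈ weilPrimeIndex b \ weilPrimeIndex a,
      (Λ n : ℝ) / Real.sqrt n * weilIncrement f (Real.log n) = (Λ n : ℝ) / Real.sqrt n * (2 * N) := by
    intro n hn
    rw [Finset.mem_sdiff, mem_weilPrimeIndex, mem_weilPrimeIndex, not_lt] at hn
    rw [WeilParity.EvenWinsArch.dilationEnergy_weilIncrement_eq_two_mul hf hfs hn.2]
  have h1 := Finset.sum_sdiff hsub
    (f := fun n : ℕ ↦ (Λ n : ℝ) / Real.sqrt n * weilIncrement f (Real.log n))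
  have h2 := Finset.sum_sdiff hsub (f := fun n : ℕ ↦ (Λ n : ℝ) / Real.sqrt n)
  have h3 : ∑ n ∈ weilPrimeIndex b \ weilPrimeIndex a,
      (Λ n : ℝ) / Real.sqrt n * weilIncrement f (Real.log n) =
        (∑ n ∈ weilPrimeIndex b \ weilPrimeIndex a, (Λ n : ℝ) / Real.sqrt n) * (2 * N) := by
    rw [Finset.sum_mul]
    exact Finset.sum_congr rfl hD
  unfold weilDirichletEnergy weilMarkovConstant
  rw [← h1, ← h2, h3]
  ring

/-! ### One step and the limit -/

/-- **One step, odd sector.** For an ODD test function `g` on the window `[-b, b]`, `b ≥ a`, whose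
increments are dominated by those of a finite-energy `f` living on `[-a, a]`:
`ε_od(b)‖g‖² + M_a‖f‖² + M_b(‖g‖² − ‖f‖²) ≤ P(g) + 𝓔_a(f)`. [folklore] -/
theorem odd_step_le {a b : ℝ} (hab : a ≤ b) {f g : ℝ → ℂ} (hf : MemLp f 2)
    (hfs : ∀ x, x ∉ Icc (-a) a → f x = 0)
    (harch : IntegrableOn (fun t ↦ weilArchDensity t * weilIncrement f t) (Ioi 0))
    (hg : IsWeilTest g) (hgs : tsupport g ⊆ Icc (-b) b) (hgo : ∀ x, g (-x) = -g x)
    (hD : ∀ t, weilIncrement g t ≤ weilIncrement f t) :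
    weilOddGroundEnergy b * (∫ x, ‖g x‖ ^ 2) + weilMarkovConstant a * (∫ x, ‖f x‖ ^ 2) +
        weilMarkovConstant b * ((∫ x, ‖g x‖ ^ 2) - ∫ x, ‖f x‖ ^ 2) ≤
      weilPoleForm g + weilDirichletEnergy a f := by
  -- adapted from the private `step_le` (route WeilWindowFlow), ε ↦ ε_od
  have h1 := weilOddGroundEnergy_mul_le_re hg hgs hgo
  have h2 := weilQuadratic_re_eq_weilPoleForm_add_weilDirichletEnergy_sub hg hgs
  have h3 : weilDirichletEnergy b g ≤ weilDirichletEnergy b f := by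
    unfold weilDirichletEnergy
    refine add_le_add (Finset.sum_le_sum fun n _ ↦ mul_le_mul_of_nonneg_left (hD _)
      (div_nonneg ArithmeticFunction.vonMangoldt_nonneg (Real.sqrt_nonneg _))) ?_
    refine integral_mono_of_nonneg ?_ harch ?_
    · exact (ae_restrict_iff' measurableSet_Ioi).2 (Eventually.of_forall fun t ht ↦
        mul_nonneg (weilArchDensity_pos ht).le (weilIncrement_nonneg _ t))
    · exact (ae_restrict_iff' measurableSet_Ioi).2 (Eventually.of_forall fun t ht ↦
        mul_le_mul_of_nonneg_left (hD t) (weilArchDensity_pos ht).le)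
  have h4 := weilDirichletEnergy_window' hab hf hfs
  rw [sub_mul] at h4
  rw [mul_sub]
  linarith

/-- **Odd window tests are dense from above in the odd form domain** (registered sub-goal
`odd_formDomainPos` of item stmt-RiemannHypothesis-17778): for every ODD `f ∈ L²` vanishing off
`[-a, a]` (`a > 0`) with finite archimedean energy, `(M_a + ε_od(a))‖f‖₂² ≤ P(f) + 𝓔_a(f)`.
[folklore] -/
theorem odd_formDomainPos :
    ∀ (a : ℝ) (f : ℝ → ℂ), 0 < a → MemLp f 2 → (∀ x, x ∉ Icc (-a) a → f x = 0) →
      (∀ x, f (-x) = -f x) →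
      IntegrableOn (fun t ↦ weilArchDensity t * weilIncrement f t) (Ioi 0) →
        (weilMarkovConstant a + weilOddGroundEnergy a) * ∫ x, ‖f x‖ ^ 2 ≤
          weilPoleForm f + weilDirichletEnergy a f := by
  -- adapted from the private `core_le` (route WeilWindowFlow), odd sector
  intro a f ha hf hfs hfo harch
  obtain ⟨g, hg, hgo, hgs, hD, hlim⟩ := exists_odd_mollified_seq hf hfs hfo
  have hr0 : ∀ n : ℕ, (0 : ℝ) < 1 / ((n : ℝ) + 1) := fun n ↦ by positivity
  have hr1 : ∀ n : ℕ, 1 / ((n : ℝ) + 1) ≤ 1 := fun n ↦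
    div_le_one_of_le₀ (by linarith [n.cast_nonneg (α := ℝ)]) (by positivity)
  have hgm : ∀ n, MemLp (g n) 2 := fun n ↦ (hg n).memLp_two
  have hN : Tendsto (fun n ↦ ∫ x, ‖g n x‖ ^ 2) atTop (𝓝 (∫ x, ‖f x‖ ^ 2)) :=
    tendsto_integral_norm_sq hf hgm hlim
  have hfR : ∀ x, x ∉ Icc (-(a + 1)) (a + 1) → f x = 0 := fun x hx ↦
    hfs x fun h ↦ hx (Icc_subset_Icc (by linarith) (by linarith) h)
  have hgR : ∀ n x, x ∉ Icc (-(a + 1)) (a + 1) → g n x = 0 := fun n x hx ↦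
    image_eq_zero_of_notMem_tsupport fun h ↦
      hx (Icc_subset_Icc (by linarith [hr1 n]) (by linarith [hr1 n]) (hgs n h))
  have hP : Tendsto (fun n ↦ weilPoleForm (g n)) atTop (𝓝 (weilPoleForm f)) :=
    tendsto_weilPoleForm_of_window hf hgm hfR hgR hlim
  have hb : Tendsto (fun n : ℕ ↦ a + 1 / ((n : ℝ) + 1)) atTop (𝓝 a) := by
    have := (tendsto_const_nhds (x := a) (f := (atTop : Filter ℕ))).add
      (tendsto_one_div_add_atTop_nhds_zero_nat (𝕜 := ℝ))
    rwa [add_zero] at this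
  have hε : Tendsto (fun n : ℕ ↦ weilOddGroundEnergy (a + 1 / ((n : ℝ) + 1))) atTop
      (𝓝 (weilOddGroundEnergy a)) :=
    (stub_sectorContinuity_continuousAt_odd ha).tendsto.comp hb
  have hMB : ∀ n : ℕ, |weilMarkovConstant (a + 1 / ((n : ℝ) + 1))| ≤
      |weilMarkovConstant a| + |weilMarkovConstant (a + 1)| := fun n ↦ by
    have h1 := stub_supBound_weilMarkovConstant_mono (show a ≤ a + 1 / ((n : ℝ) + 1) by linarith [hr0 n])
    have h2 := stub_supBound_weilMarkovConstant_mono (show a + 1 / ((n : ℝ) + 1) ≤ a + 1 by linarith [hr1 n])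
    rcases abs_cases (weilMarkovConstant (a + 1 / ((n : ℝ) + 1))) with h | h <;>
    rcases abs_cases (weilMarkovConstant a) with h' | h' <;>
    rcases abs_cases (weilMarkovConstant (a + 1)) with h'' | h'' <;> linarith
  have hM : Tendsto (fun n : ℕ ↦ weilMarkovConstant (a + 1 / ((n : ℝ) + 1)) *
      ((∫ x, ‖g n x‖ ^ 2) - ∫ x, ‖f x‖ ^ 2)) atTop (𝓝 0) := by
    refine squeeze_zero_norm (fun n ↦ ?_)
      (a := fun n ↦ (|weilMarkovConstant a| + |weilMarkovConstant (a + 1)|) *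
        |(∫ x, ‖g n x‖ ^ 2) - ∫ x, ‖f x‖ ^ 2|) ?_
    · rw [norm_mul, Real.norm_eq_abs, Real.norm_eq_abs]
      exact mul_le_mul_of_nonneg_right (hMB n) (abs_nonneg _)
    · have := (tendsto_sub_nhds_zero_iff.2 hN).abs.const_mul
        (|weilMarkovConstant a| + |weilMarkovConstant (a + 1)|)
      simpa using this
  have hL := ((hε.mul hN).add (tendsto_const_nhds
    (x := weilMarkovConstant a * ∫ x, ‖f x‖ ^ 2) (f := (atTop : Filter ℕ)))).add hM
  have hR := hP.add (tendsto_const_nhds (x := weilDirichletEnergy a f) (f := (atTop : Filter ℕ)))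
  have key := le_of_tendsto_of_tendsto' hL hR fun n ↦
    odd_step_le (show a ≤ a + 1 / ((n : ℝ) + 1) by linarith [hr0 n]) hf hfs harch (hg n) (hgs n)
      (hgo n) (hD n)
  rw [add_mul]
  linarith

/-- **A.e. form of `odd_formDomainPos`.** The same inequality for `f ∈ L²` that vanishes A.E. off
`[-a, a]` and is odd A.E. (`f(-x) = -f(x)` for a.e. `x`): `P`, `𝓔_a` and `‖·‖₂` only see the
a.e. class, and the class contains an everywhere odd representative living on the window
(`x ↦ 𝟙_{[-a,a]}(x) (f(x) − f(−x))/2`). [folklore] -/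
theorem odd_formDomainPos_ae {a : ℝ} (ha : 0 < a) {f : ℝ → ℂ} (hf : MemLp f 2)
    (hz : ∀ᵐ x : ℝ, x ∉ Icc (-a) a → f x = 0) (hodd : ∀ᵐ x : ℝ, f (-x) = -f x)
    (harch : IntegrableOn (fun t ↦ weilArchDensity t * weilIncrement f t) (Ioi 0)) :
    (weilMarkovConstant a + weilOddGroundEnergy a) * ∫ x, ‖f x‖ ^ 2 ≤
      weilPoleForm f + weilDirichletEnergy a f := by
  set f' : ℝ → ℂ := (Icc (-a) a).indicator fun x ↦ (f x - f (-x)) / 2 with hf'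
  have hin : ∀ x, x ∈ Icc (-a) a → f' x = (f x - f (-x)) / 2 := fun x hx ↦ indicator_of_mem hx _
  have hout : ∀ x, x ∉ Icc (-a) a → f' x = 0 := fun x hx ↦ indicator_of_notMem hx _
  have hsymm : ∀ x : ℝ, -x ∈ Icc (-a) a ↔ x ∈ Icc (-a) a := fun x ↦ by
    simp only [mem_Icc]; constructor <;> intro h <;> constructor <;> linarith [h.1, h.2]
  have hf'o : ∀ x, f' (-x) = -f' x := fun x ↦ by
    by_cases hx : x ∈ Icc (-a) a
    · rw [hin x hx, hin (-x) ((hsymm x).2 hx), neg_neg]; ring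
    · rw [hout x hx, hout (-x) (mt (hsymm x).1 hx), neg_zero]
  have hff' : f =ᵐ[volume] f' := by
    filter_upwards [hz, hodd] with x h1 h2
    by_cases hx : x ∈ Icc (-a) a
    · rw [hin x hx, h2]; ring
    · rw [hout x hx, h1 hx]
  have hf'm : MemLp f' 2 := MemLp.ae_eq hff' hf
  have hN : ∫ x, ‖f x‖ ^ 2 = ∫ x, ‖f' x‖ ^ 2 :=
    integral_congr_ae (hff'.mono fun x hx ↦ by simp only [hx])
  have hmul : ∀ w : ℝ → ℂ, ∫ t, f t * w t = ∫ t, f' t * w t := fun w ↦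
    integral_congr_ae (hff'.mono fun x hx ↦ by simp only [hx])
  have hP : weilPoleForm f = weilPoleForm f' := by
    unfold weilPoleForm
    rw [hmul (fun t ↦ (Real.cosh (t / 2) : ℂ)), hmul (fun t ↦ (Real.sinh (t / 2) : ℂ))]
  have hD : weilIncrement f = weilIncrement f' := weilIncrement_congr_ae hff'
  have hE : weilDirichletEnergy a f = weilDirichletEnergy a f' := weilDirichletEnergy_congr_ae a hff'
  rw [hN, hP, hE]
  rw [hD] at harch
  exact odd_formDomainPos a f' ha hf'm hout hf'o harch

/-- **Odd ground states minimise `P + 𝓔_a` on the odd form domain of the window**: if `u` is an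
odd-sector ground state at `a` and `f` is any odd `L²` function vanishing off `[-a, a]` with finite
archimedean energy, then `(P(u) + 𝓔_a(u)) · ‖f‖₂² ≤ P(f) + 𝓔_a(f)` — literally:
`P(u) + 𝓔_a(u) ≤ M_a + ε_od(a)` (`oddGroundState_finiteEnergy`) and
`(M_a + ε_od(a))‖f‖² ≤ P(f) + 𝓔_a(f)`. Stated here as the chain of the two inequalities.
[folklore] -/
theorem weilPoleForm_add_weilDirichletEnergy_le_of_odd {a : ℝ} (ha : 0 < a) {f : ℝ → ℂ}
    (hf : MemLp f 2) (hfs : ∀ x, x ∉ Icc (-a) a → f x = 0) (hfo : ∀ x, f (-x) = -f x)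
    (harch : IntegrableOn (fun t ↦ weilArchDensity t * weilIncrement f t) (Ioi 0))
    (hfn : ∫ x, ‖f x‖ ^ 2 = 1) :
    weilMarkovConstant a + weilOddGroundEnergy a ≤ weilPoleForm f + weilDirichletEnergy a f := by
  have := odd_formDomainPos a f ha hf hfs hfo harch
  rwa [hfn, mul_one] at this

end Summit.RiemannHypothesis.RiemannHypothesis.Theorems.OddSector

end
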